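import Summits.NavierStokesRegularity.NavierStokesRegularity.Theorems.FilamentSkeletonRssCoreLinearInvertibilityClassClosureToolsB
import Literature.Analysis.FluidPDE.GaussianVortexKernelRadial
import Literature.Analysis.FluidPDE.BiotSavart2DSymmetry
import Literature.Analysis.FluidPDE.PineauVicolWeightedIdentity

/-!
# Tools for stub `stub_oddSymmetrizerBoundedBelow` (crux `CoreLinearInvertibility`,
# stmt-NavierStokesRegularity-17973, route `FilamentSkeletonRss`, line `Sketch`) — part B:
# the logarithmic potential of an `X_λ` density

For the planar logarithmic potential `ψ_a(x) = ∫ N(x − y) a(y) dy`, `N = (2π)⁻¹ log ‖·‖`, of a density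
`a ∈ X_λ = L²(G_λ⁻¹ dx)` (`G_λ = gaussWeightLam λ`, `λ < 1`):

* `log² ‖z‖ ≤ 4 · 𝟙_{‖z‖<1} ‖z‖⁻¹ + ‖z‖²`, hence `∫ log² ‖x − y‖ G_λ(y) dy ≤ K (1 + ‖x‖)²`;
* **the pointwise bound** `|ψ_a(x)| ≤ K (1 + ‖x‖) ‖a‖_{X_λ}` (weighted Cauchy–Schwarz), with absolute
  convergence of the defining integral, and consequently
  **`∫ Φ(|x|) ψ_a(x)² dx ≤ K' ‖a‖²_{X_λ}`** (`Φ = kerWeight ≤ e^{−r²/8}`): the operator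
  `a ↦ Φ ψ_a` is bounded from `X_λ` to `L²(Φ⁻¹ dx)`;
* measurability of `ψ_a`, oddness of `ψ_a` for odd `a`, linearity in `a`, and continuity of `ψ_w`
  for a compactly supported `C¹` density (tree: `contDiff_one_logPotential_of_gaussBound`).

References: Th. Gallay, V. Šverák, arXiv:2110.13739, §2 (2.6)–(2.8) (the energy of an `X`
density); folklore potential theory.
-/

set_option linter.dupNamespace false

noncomputable section

namespace Summit.NavierStokesRegularity.NavierStokesRegularity.Theorems

open Set Function Filter MeasureTheory Topology Metric
open Literature.Analysis.FluidPDE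

/-! ### The squared logarithmic kernel against the Gaussian weight -/

/-- `log² ‖z‖ ≤ 4 · 𝟙_{‖z‖<1} ‖z‖⁻¹ + ‖z‖²` (`|log t| √t < 2` on `(0,1]`, `0 ≤ log t ≤ t` on `[1,∞)`).
[folklore] -/
theorem arnold_sq_log_norm_le (z : EuclideanSpace ℝ (Fin 2)) :
    Real.log ‖z‖ ^ 2 ≤
      4 * (ball (0 : EuclideanSpace ℝ (Fin 2)) 1).indicator (fun z => ‖z‖⁻¹) z + ‖z‖ ^ 2 := by
  by_cases hz : z = 0
  · subst hz; simp
  have hn : 0 < ‖z‖ := norm_pos_iff.2 hz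
  by_cases h1 : ‖z‖ < 1
  · rw [indicator_of_mem (mem_ball_zero_iff.2 h1)]
    have h := Real.abs_log_mul_self_rpow_lt ‖z‖ (1 / 2) hn h1.le (by norm_num)
    rw [show (1 : ℝ) / (1 / 2) = 2 by norm_num] at h
    have hsq : (Real.log ‖z‖ * ‖z‖ ^ (1 / 2 : ℝ)) ^ 2 ≤ 2 ^ 2 := by
      rw [← sq_abs]
      exact pow_le_pow_left₀ (abs_nonneg _) h.le 2
    have e : (Real.log ‖z‖ * ‖z‖ ^ (1 / 2 : ℝ)) ^ 2 = Real.log ‖z‖ ^ 2 * ‖z‖ := by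
      rw [mul_pow, ← Real.rpow_natCast (‖z‖ ^ (1 / 2 : ℝ)), ← Real.rpow_mul hn.le]
      norm_num
    rw [e] at hsq
    have h3 : Real.log ‖z‖ ^ 2 ≤ 4 * ‖z‖⁻¹ := by
      rw [← div_eq_mul_inv, le_div_iff₀ hn]; linarith
    nlinarith [sq_nonneg ‖z‖]
  · rw [indicator_of_notMem (by rwa [mem_ball_zero_iff]), mul_zero, zero_add]
    have hl0 : 0 ≤ Real.log ‖z‖ := Real.log_nonneg (not_lt.1 h1)
    have hl1 : Real.log ‖z‖ ≤ ‖z‖ := (Real.log_le_sub_one_of_pos hn).trans (by linarith)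
    exact pow_le_pow_left₀ hl0 hl1 2

/-- **`∫ log² ‖x − y‖ G_λ(y) dy ≤ K (1 + ‖x‖)²`** for `λ < 1`, with integrability of the integrand
(`log² ≤ 4 𝟙‖·‖⁻¹ + 2‖x‖² + 2‖y‖²`, `𝟙_{B}‖z‖⁻¹ ∈ L¹(ℝ²)`, `∫ G_λ = 1`, `∫ |y|² G_λ < ∞`). [folklore] -/
theorem arnold_integral_sq_log_mul_gaussWeightLam_le {lam : ℝ} (hlam : lam < 1) :
    ∃ K : ℝ, 0 < K ∧ ∀ x : EuclideanSpace ℝ (Fin 2),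
      Integrable (fun y => Real.log ‖x - y‖ ^ 2 * gaussWeightLam lam y) ∧
      ∫ y, Real.log ‖x - y‖ ^ 2 * gaussWeightLam lam y ≤ K * (1 + ‖x‖) ^ 2 := by
  set Gm : ℝ := (1 - lam) / (4 * Real.pi) with hGm
  set I₁ : ℝ := ∫ z, (ball (0 : EuclideanSpace ℝ (Fin 2)) 1).indicator (fun z => ‖z‖⁻¹) z with hI₁
  set C₂ : ℝ := ∫ y, ‖y‖ ^ 2 * gaussWeightLam lam y with hC₂
  have hl : 0 < 1 - lam := by linarith
  have hGm0 : 0 ≤ Gm := by positivity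
  have hI₁0 : 0 ≤ I₁ := integral_nonneg indicator_inv_norm_nonneg
  have hC₂0 : 0 ≤ C₂ := integral_nonneg fun y => mul_nonneg (sq_nonneg _) (gaussWeightLam_pos hlam y).le
  refine ⟨4 * Gm * I₁ + 2 * C₂ + 2, by positivity, fun x => ?_⟩
  set F : EuclideanSpace ℝ (Fin 2) → ℝ := fun y =>
    4 * Gm * (ball (0 : EuclideanSpace ℝ (Fin 2)) 1).indicator (fun z => ‖z‖⁻¹) (x - y) +
      2 * ‖x‖ ^ 2 * gaussWeightLam lam y + 2 * (‖y‖ ^ 2 * gaussWeightLam lam y) with hF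
  have hi1 : Integrable fun y : EuclideanSpace ℝ (Fin 2) =>
      4 * Gm * (ball (0 : EuclideanSpace ℝ (Fin 2)) 1).indicator (fun z => ‖z‖⁻¹) (x - y) :=
    (integrable_indicator_inv_norm.comp_sub_left x).const_mul _
  have hi2 : Integrable fun y : EuclideanSpace ℝ (Fin 2) => 2 * ‖x‖ ^ 2 * gaussWeightLam lam y :=
    (integrable_gaussWeightLam hlam).const_mul _
  have hi3 : Integrable fun y : EuclideanSpace ℝ (Fin 2) => 2 * (‖y‖ ^ 2 * gaussWeightLam lam y) :=
    (integrable_norm_sq_mul_gaussWeightLam hlam).const_mul _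
  have hi12 : Integrable fun y : EuclideanSpace ℝ (Fin 2) =>
      4 * Gm * (ball (0 : EuclideanSpace ℝ (Fin 2)) 1).indicator (fun z => ‖z‖⁻¹) (x - y) +
        2 * ‖x‖ ^ 2 * gaussWeightLam lam y := hi1.add hi2
  have hFint : Integrable F := hi12.add hi3
  have hFI : ∫ y, F y = 4 * Gm * I₁ + 2 * ‖x‖ ^ 2 + 2 * C₂ := by
    simp only [hF]
    rw [integral_add hi12 hi3, integral_add hi1 hi2, integral_const_mul, integral_const_mul,
      integral_const_mul, integral_gaussWeightLam hlam,
      integral_sub_left_eq_self ((ball (0 : EuclideanSpace ℝ (Fin 2)) 1).indicator fun z => ‖z‖⁻¹)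
        volume x]
    ring
  have hmeas : AEStronglyMeasurable (fun y => Real.log ‖x - y‖ ^ 2 * gaussWeightLam lam y) volume :=
    (((measurable_const.sub measurable_id).norm.log.pow_const 2).mul
      (continuous_gaussWeightLam lam).measurable).aestronglyMeasurable
  have hpt : ∀ y, ‖Real.log ‖x - y‖ ^ 2 * gaussWeightLam lam y‖ ≤ F y := by
    intro y
    have hG := gaussWeightLam_pos hlam y
    have hGle : gaussWeightLam lam y ≤ Gm := gaussWeightLam_le hlam y
    rw [Real.norm_of_nonneg (mul_nonneg (sq_nonneg _) hG.le)]
    have h1 := arnold_sq_log_norm_le (x - y)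
    have h2 : ‖x - y‖ ^ 2 ≤ 2 * ‖x‖ ^ 2 + 2 * ‖y‖ ^ 2 := by
      have ha : ‖x - y‖ ^ 2 ≤ (‖x‖ + ‖y‖) ^ 2 :=
        pow_le_pow_left₀ (norm_nonneg _) (norm_sub_le x y) 2
      nlinarith [sq_nonneg (‖x‖ - ‖y‖)]
    have h4 := indicator_inv_norm_nonneg (x - y)
    calc Real.log ‖x - y‖ ^ 2 * gaussWeightLam lam y
        ≤ (4 * (ball (0 : EuclideanSpace ℝ (Fin 2)) 1).indicator (fun z => ‖z‖⁻¹) (x - y) +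
            (2 * ‖x‖ ^ 2 + 2 * ‖y‖ ^ 2)) * gaussWeightLam lam y :=
          mul_le_mul_of_nonneg_right (by linarith) hG.le
      _ = 4 * ((ball (0 : EuclideanSpace ℝ (Fin 2)) 1).indicator (fun z => ‖z‖⁻¹) (x - y) *
            gaussWeightLam lam y) + 2 * ‖x‖ ^ 2 * gaussWeightLam lam y +
            2 * (‖y‖ ^ 2 * gaussWeightLam lam y) := by ring
      _ ≤ 4 * ((ball (0 : EuclideanSpace ℝ (Fin 2)) 1).indicator (fun z => ‖z‖⁻¹) (x - y) * Gm) +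
            2 * ‖x‖ ^ 2 * gaussWeightLam lam y + 2 * (‖y‖ ^ 2 * gaussWeightLam lam y) := by
          gcongr
      _ = F y := by simp only [hF]; ring
  refine ⟨hFint.mono' hmeas (Eventually.of_forall hpt), ?_⟩
  calc ∫ y, Real.log ‖x - y‖ ^ 2 * gaussWeightLam lam y ≤ ∫ y, F y :=
        integral_mono_of_nonneg (Eventually.of_forall fun y =>
          mul_nonneg (sq_nonneg _) (gaussWeightLam_pos hlam y).le) hFint
          (Eventually.of_forall fun y => (Real.le_norm_self _).trans (hpt y))
    _ = 4 * Gm * I₁ + 2 * ‖x‖ ^ 2 + 2 * C₂ := hFI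
    _ ≤ (4 * Gm * I₁ + 2 * C₂ + 2) * (1 + ‖x‖) ^ 2 := by
        nlinarith [norm_nonneg x, mul_nonneg (mul_nonneg (by norm_num : (0:ℝ) ≤ 4) hGm0) hI₁0]

/-! ### The pointwise bound on the logarithmic potential of an `X_λ` density -/

/-- **`|ψ_a(x)| ≤ K (1 + ‖x‖) ‖a‖_{X_λ}`** for every measurable `a` with `∫ G_λ⁻¹ a² < ∞`, `λ < 1`,
where `ψ_a(x) = ∫ (2π)⁻¹ log ‖x − y‖ a(y) dy` converges absolutely (weighted Cauchy–Schwarz: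
`|∫ N(x−y) a| ≤ (∫ N(x−y)² G_λ)^{1/2} (∫ G_λ⁻¹ a²)^{1/2}`). [folklore] -/
theorem arnold_logPotential_bound {lam : ℝ} (hlam : lam < 1) :
    ∃ K : ℝ, 0 < K ∧ ∀ a : EuclideanSpace ℝ (Fin 2) → ℝ, AEStronglyMeasurable a volume →
      Integrable (fun x => (gaussWeightLam lam x)⁻¹ * a x ^ 2) →
      ∀ x : EuclideanSpace ℝ (Fin 2),
        Integrable (fun y => (2 * Real.pi)⁻¹ * Real.log ‖x - y‖ * a y) ∧
        |∫ y, (2 * Real.pi)⁻¹ * Real.log ‖x - y‖ * a y| ≤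
          K * (1 + ‖x‖) * Real.sqrt (∫ y, (gaussWeightLam lam y)⁻¹ * a y ^ 2) := by
  obtain ⟨K₀, hK₀, hb⟩ := arnold_integral_sq_log_mul_gaussWeightLam_le hlam
  refine ⟨(2 * Real.pi)⁻¹ * Real.sqrt K₀, by positivity, fun a ham haX x => ?_⟩
  obtain ⟨hint, hle⟩ := hb x
  have hg : ∀ y, 0 ≤ (gaussWeightLam lam y)⁻¹ := fun y => inv_nonneg.2 (gaussWeightLam_pos hlam y).le
  have hgm : AEStronglyMeasurable (fun y => (gaussWeightLam lam y)⁻¹) volume :=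
    (continuous_inv_gaussWeightLam hlam).aestronglyMeasurable
  have hAm : AEStronglyMeasurable
      (fun y => (2 * Real.pi)⁻¹ * Real.log ‖x - y‖ * gaussWeightLam lam y) volume :=
    ((measurable_const.mul (measurable_const.sub measurable_id).norm.log).mul
      (continuous_gaussWeightLam lam).measurable).aestronglyMeasurable
  have hA : Integrable (fun y => (gaussWeightLam lam y)⁻¹ *
      ((2 * Real.pi)⁻¹ * Real.log ‖x - y‖ * gaussWeightLam lam y) ^ 2) := by
    refine (hint.const_mul ((2 * Real.pi)⁻¹ ^ 2)).congr (Eventually.of_forall fun y => ?_)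
    have hG := (gaussWeightLam_pos hlam y).ne'
    simp only
    field_simp
  have hAval : ∫ y, (gaussWeightLam lam y)⁻¹ *
      ((2 * Real.pi)⁻¹ * Real.log ‖x - y‖ * gaussWeightLam lam y) ^ 2 =
      (2 * Real.pi)⁻¹ ^ 2 * ∫ y, Real.log ‖x - y‖ ^ 2 * gaussWeightLam lam y := by
    rw [← integral_const_mul]
    refine integral_congr_ae (Eventually.of_forall fun y => ?_)
    have hG := (gaussWeightLam_pos hlam y).ne'
    simp only
    field_simp
  obtain ⟨hprod, hcs⟩ := abs_integral_weight_mul_mul_le (μ := volume) hg hgm hAm ham hA haX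
  have hfun : (fun y => (gaussWeightLam lam y)⁻¹ *
      ((2 * Real.pi)⁻¹ * Real.log ‖x - y‖ * gaussWeightLam lam y * a y)) =
      fun y => (2 * Real.pi)⁻¹ * Real.log ‖x - y‖ * a y := by
    funext y
    have hG := (gaussWeightLam_pos hlam y).ne'
    field_simp
  rw [hfun] at hprod hcs
  refine ⟨hprod, hcs.trans ?_⟩
  rw [hAval, Real.sqrt_mul (sq_nonneg _), Real.sqrt_sq (by positivity)]
  have h1 : Real.sqrt (∫ y, Real.log ‖x - y‖ ^ 2 * gaussWeightLam lam y) ≤ Real.sqrt K₀ * (1 + ‖x‖) := by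
    calc Real.sqrt (∫ y, Real.log ‖x - y‖ ^ 2 * gaussWeightLam lam y)
        ≤ Real.sqrt (K₀ * (1 + ‖x‖) ^ 2) := Real.sqrt_le_sqrt hle
      _ = Real.sqrt K₀ * (1 + ‖x‖) := by
          rw [Real.sqrt_mul hK₀.le, Real.sqrt_sq (by positivity)]
  have hS := Real.sqrt_nonneg (∫ y, (gaussWeightLam lam y)⁻¹ * a y ^ 2)
  calc (2 * Real.pi)⁻¹ * Real.sqrt (∫ y, Real.log ‖x - y‖ ^ 2 * gaussWeightLam lam y) *
        Real.sqrt (∫ y, (gaussWeightLam lam y)⁻¹ * a y ^ 2)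
      ≤ (2 * Real.pi)⁻¹ * (Real.sqrt K₀ * (1 + ‖x‖)) *
        Real.sqrt (∫ y, (gaussWeightLam lam y)⁻¹ * a y ^ 2) := by gcongr
    _ = _ := by ring

/-- **Measurability of the logarithmic potential** of a measurable density. [folklore] -/
theorem arnold_aestronglyMeasurable_logPotential {a : EuclideanSpace ℝ (Fin 2) → ℝ}
    (ham : AEStronglyMeasurable a volume) :
    AEStronglyMeasurable (fun x : EuclideanSpace ℝ (Fin 2) =>
      ∫ y, (2 * Real.pi)⁻¹ * Real.log ‖x - y‖ * a y) volume := by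
  have h : AEStronglyMeasurable (fun p : EuclideanSpace ℝ (Fin 2) × EuclideanSpace ℝ (Fin 2) =>
      (2 * Real.pi)⁻¹ * Real.log ‖p.1 - p.2‖ * a p.2) (volume.prod volume) :=
    ((measurable_const.mul (measurable_fst.sub measurable_snd).norm.log).aestronglyMeasurable).mul
      ham.comp_snd
  exact h.integral_prod_right'

/-- **`a ↦ Φ ψ_a` is bounded from `X_λ` to `L²(Φ⁻¹ dx)`**: for a measurable `a ∈ X_λ` and
`ψ = ψ_a`, the weighted square `Φ⁻¹ (Φ ψ)² = Φ ψ²` is integrable with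
`∫ Φ⁻¹(Φψ)² ≤ K ∫ G_λ⁻¹ a²` (`Φ ≤ e^{−r²/8}` and the pointwise bound on `ψ`). [folklore] -/
theorem arnold_integral_kerWeight_mul_logPotential_sq_le {lam : ℝ} (hlam : lam < 1) :
    ∃ K : ℝ, 0 < K ∧ ∀ a ψ : EuclideanSpace ℝ (Fin 2) → ℝ, AEStronglyMeasurable a volume →
      Integrable (fun x => (gaussWeightLam lam x)⁻¹ * a x ^ 2) →
      (∀ x, ψ x = ∫ y, (2 * Real.pi)⁻¹ * Real.log ‖x - y‖ * a y) →
      Integrable (fun x => (kerWeight ‖x‖)⁻¹ * (kerWeight ‖x‖ * ψ x) ^ 2) ∧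
      ∫ x, (kerWeight ‖x‖)⁻¹ * (kerWeight ‖x‖ * ψ x) ^ 2 ≤
        K * ∫ x, (gaussWeightLam lam x)⁻¹ * a x ^ 2 := by
  obtain ⟨K, hK, hb⟩ := arnold_logPotential_bound hlam
  set I₈ : ℝ := ∫ x : EuclideanSpace ℝ (Fin 2), (1 + ‖x‖) ^ 2 * Real.exp (-(1 / 8) * ‖x‖ ^ 2) with hI₈
  have hI₈0 : 0 ≤ I₈ := integral_nonneg fun x => by positivity
  refine ⟨K ^ 2 * I₈ + 1, by positivity, fun a ψ ham haX hψ => ?_⟩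
  set S : ℝ := Real.sqrt (∫ y, (gaussWeightLam lam y)⁻¹ * a y ^ 2) with hS
  have hS0 : 0 ≤ S := Real.sqrt_nonneg _
  have hS2 : S ^ 2 = ∫ y, (gaussWeightLam lam y)⁻¹ * a y ^ 2 :=
    Real.sq_sqrt (integral_nonneg fun y => mul_nonneg
      (inv_nonneg.2 (gaussWeightLam_pos hlam y).le) (sq_nonneg _))
  have hψm : AEStronglyMeasurable ψ volume := by
    have : ψ = fun x => ∫ y, (2 * Real.pi)⁻¹ * Real.log ‖x - y‖ * a y := funext hψ
    rw [this]; exact arnold_aestronglyMeasurable_logPotential ham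
  have hmeas : AEStronglyMeasurable (fun x => (kerWeight ‖x‖)⁻¹ * (kerWeight ‖x‖ * ψ x) ^ 2) volume := by
    have hΦ : Continuous fun x : EuclideanSpace ℝ (Fin 2) => kerWeight ‖x‖ :=
      continuous_kerWeight.comp continuous_norm
    exact ((hΦ.inv₀ fun x => (kerWeight_pos _).ne').aestronglyMeasurable).mul
      ((hΦ.aestronglyMeasurable.mul hψm).pow 2)
  have hmaj := (PineauVicol2026.integrable_one_add_norm_pow_mul_exp_neg_mul_sq
    (E := EuclideanSpace ℝ (Fin 2)) (c := 1 / 8) (by norm_num) 2).const_mul (K ^ 2 * S ^ 2)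
  have hpt : ∀ x, ‖(kerWeight ‖x‖)⁻¹ * (kerWeight ‖x‖ * ψ x) ^ 2‖ ≤
      K ^ 2 * S ^ 2 * ((1 + ‖x‖) ^ 2 * Real.exp (-(1 / 8) * ‖x‖ ^ 2)) := by
    intro x
    have hΦ := kerWeight_pos ‖x‖
    have e : (kerWeight ‖x‖)⁻¹ * (kerWeight ‖x‖ * ψ x) ^ 2 = kerWeight ‖x‖ * ψ x ^ 2 := by
      field_simp
    rw [e, Real.norm_of_nonneg (mul_nonneg hΦ.le (sq_nonneg _))]
    have h1 : ψ x ^ 2 ≤ (K * (1 + ‖x‖) * S) ^ 2 := by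
      rw [← sq_abs, hψ x]
      exact pow_le_pow_left₀ (abs_nonneg _) (hb a ham haX x).2 2
    have h2 : kerWeight ‖x‖ ≤ Real.exp (-(1 / 8) * ‖x‖ ^ 2) := by
      have := kerWeight_le_exp ‖x‖; convert this using 2; ring
    calc kerWeight ‖x‖ * ψ x ^ 2 ≤ Real.exp (-(1 / 8) * ‖x‖ ^ 2) * (K * (1 + ‖x‖) * S) ^ 2 :=
          mul_le_mul h2 h1 (sq_nonneg _) (Real.exp_pos _).le
      _ = _ := by ring
  have hint : Integrable (fun x => (kerWeight ‖x‖)⁻¹ * (kerWeight ‖x‖ * ψ x) ^ 2) :=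
    hmaj.mono' hmeas (Eventually.of_forall hpt)
  refine ⟨hint, ?_⟩
  calc ∫ x, (kerWeight ‖x‖)⁻¹ * (kerWeight ‖x‖ * ψ x) ^ 2
      ≤ ∫ x, K ^ 2 * S ^ 2 * ((1 + ‖x‖) ^ 2 * Real.exp (-(1 / 8) * ‖x‖ ^ 2)) :=
        integral_mono_of_nonneg (Eventually.of_forall fun x =>
          mul_nonneg (inv_nonneg.2 (kerWeight_pos _).le) (sq_nonneg _)) hmaj
          (Eventually.of_forall fun x => (Real.le_norm_self _).trans (hpt x))
    _ = K ^ 2 * I₈ * S ^ 2 := by rw [integral_const_mul]; ring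
    _ ≤ (K ^ 2 * I₈ + 1) * S ^ 2 := by nlinarith [sq_nonneg S]
    _ = _ := by rw [hS2]

/-! ### Symmetry, linearity, continuity -/

/-- **The potential of an odd density is odd**: `ψ_a(−x) = −ψ_a(x)` (substitute `y ↦ −y`; no
integrability needed). [folklore] -/
theorem arnold_logPotential_neg_of_odd {a : EuclideanSpace ℝ (Fin 2) → ℝ}
    (hodd : ∀ x, a (-x) = -a x) (x : EuclideanSpace ℝ (Fin 2)) :
    ∫ y, (2 * Real.pi)⁻¹ * Real.log ‖-x - y‖ * a y =
      -∫ y, (2 * Real.pi)⁻¹ * Real.log ‖x - y‖ * a y := by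
  rw [← integral_neg, ← integral_neg_eq_self (fun y => (2 * Real.pi)⁻¹ * Real.log ‖-x - y‖ * a y)
    volume]
  refine integral_congr_ae (Eventually.of_forall fun y => ?_)
  simp only
  rw [hodd, show -x - -y = -(x - y) by abel, norm_neg]
  ring

/-- Linearity of the potential in the density: sums. [folklore] -/
theorem arnold_logPotential_add {a b : EuclideanSpace ℝ (Fin 2) → ℝ} {x : EuclideanSpace ℝ (Fin 2)}
    (ha : Integrable (fun y => (2 * Real.pi)⁻¹ * Real.log ‖x - y‖ * a y))
    (hb : Integrable (fun y => (2 * Real.pi)⁻¹ * Real.log ‖x - y‖ * b y)) :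
    ∫ y, (2 * Real.pi)⁻¹ * Real.log ‖x - y‖ * (a y + b y) =
      (∫ y, (2 * Real.pi)⁻¹ * Real.log ‖x - y‖ * a y) +
        ∫ y, (2 * Real.pi)⁻¹ * Real.log ‖x - y‖ * b y := by
  rw [← integral_add ha hb]
  exact integral_congr_ae (Eventually.of_forall fun y => by simp only; ring)

/-- Linearity of the potential in the density: scalar multiples. [folklore] -/
theorem arnold_logPotential_const_mul (a : EuclideanSpace ℝ (Fin 2) → ℝ) (c : ℝ)
    (x : EuclideanSpace ℝ (Fin 2)) :
    ∫ y, (2 * Real.pi)⁻¹ * Real.log ‖x - y‖ * (c * a y) =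
      c * ∫ y, (2 * Real.pi)⁻¹ * Real.log ‖x - y‖ * a y := by
  rw [← integral_const_mul]
  exact integral_congr_ae (Eventually.of_forall fun y => by simp only; ring)

/-- Scalar multiples inside an absolutely convergent potential integral. [folklore] -/
theorem arnold_integrable_logKernel_mul_const_mul {a : EuclideanSpace ℝ (Fin 2) → ℝ}
    {x : EuclideanSpace ℝ (Fin 2)} (c : ℝ)
    (ha : Integrable (fun y => (2 * Real.pi)⁻¹ * Real.log ‖x - y‖ * a y)) :
    Integrable (fun y => (2 * Real.pi)⁻¹ * Real.log ‖x - y‖ * (c * a y)) :=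
  (ha.const_mul c).congr (Eventually.of_forall fun y => by simp only; ring)

/-- **First moments are controlled by the `X_λ` norm**: `|∫ x_i a| ≤ (∫ |x|² G_λ)^{1/2} ‖a‖_{X_λ}`
(weighted Cauchy–Schwarz). [folklore] -/
theorem arnold_abs_moment_le {lam : ℝ} (hlam : lam < 1) {a : EuclideanSpace ℝ (Fin 2) → ℝ}
    (ham : AEStronglyMeasurable a volume)
    (haX : Integrable (fun x => (gaussWeightLam lam x)⁻¹ * a x ^ 2)) (i : Fin 2) :
    |∫ x : EuclideanSpace ℝ (Fin 2), x i * a x| ≤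
      Real.sqrt (∫ x : EuclideanSpace ℝ (Fin 2), ‖x‖ ^ 2 * gaussWeightLam lam x) *
        Real.sqrt (∫ x, (gaussWeightLam lam x)⁻¹ * a x ^ 2) := by
  have hg : ∀ x, 0 ≤ (gaussWeightLam lam x)⁻¹ := fun x => inv_nonneg.2 (gaussWeightLam_pos hlam x).le
  have hgm : AEStronglyMeasurable (fun x => (gaussWeightLam lam x)⁻¹) volume :=
    (continuous_inv_gaussWeightLam hlam).aestronglyMeasurable
  have hAm : AEStronglyMeasurable (fun x : EuclideanSpace ℝ (Fin 2) => x i * gaussWeightLam lam x) volume :=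
    ((PiLp.continuous_apply 2 _ i).mul (continuous_gaussWeightLam lam)).aestronglyMeasurable
  have hpt : ∀ x : EuclideanSpace ℝ (Fin 2),
      (gaussWeightLam lam x)⁻¹ * (x i * gaussWeightLam lam x) ^ 2 ≤ ‖x‖ ^ 2 * gaussWeightLam lam x := by
    intro x
    have hG := gaussWeightLam_pos hlam x
    have hxi : |x i| ≤ ‖x‖ := by simpa using PiLp.norm_apply_le x i
    have h2 : x i ^ 2 ≤ ‖x‖ ^ 2 := by rw [← sq_abs]; exact pow_le_pow_left₀ (abs_nonneg _) hxi 2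
    calc (gaussWeightLam lam x)⁻¹ * (x i * gaussWeightLam lam x) ^ 2 = x i ^ 2 * gaussWeightLam lam x := by
          field_simp
      _ ≤ ‖x‖ ^ 2 * gaussWeightLam lam x := mul_le_mul_of_nonneg_right h2 hG.le
  have hnn : ∀ x : EuclideanSpace ℝ (Fin 2),
      0 ≤ (gaussWeightLam lam x)⁻¹ * (x i * gaussWeightLam lam x) ^ 2 := fun x =>
    mul_nonneg (hg x) (sq_nonneg _)
  have hA : Integrable (fun x : EuclideanSpace ℝ (Fin 2) =>
      (gaussWeightLam lam x)⁻¹ * (x i * gaussWeightLam lam x) ^ 2) :=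
    (integrable_norm_sq_mul_gaussWeightLam hlam).mono' (hgm.mul (hAm.pow 2))
      (Eventually.of_forall fun x => by rw [Real.norm_of_nonneg (hnn x)]; exact hpt x)
  obtain ⟨-, hcs⟩ := abs_integral_weight_mul_mul_le (μ := volume) hg hgm hAm ham hA haX
  have hfun : (fun x : EuclideanSpace ℝ (Fin 2) =>
      (gaussWeightLam lam x)⁻¹ * (x i * gaussWeightLam lam x * a x)) = fun x => x i * a x := by
    funext x
    have hG := (gaussWeightLam_pos hlam x).ne'
    field_simp
  rw [hfun] at hcs
  refine hcs.trans (mul_le_mul_of_nonneg_right (Real.sqrt_le_sqrt ?_) (Real.sqrt_nonneg _))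
  exact integral_mono_of_nonneg (Eventually.of_forall hnn) (integrable_norm_sq_mul_gaussWeightLam hlam)
    (Eventually.of_forall hpt)

/-! ### The registered tools stub -/

/-- **Registered tools stub `stub_oddArnoldToolsB`** (helpers for `stub_oddSymmetrizerBoundedBelow`, line
`Sketch` of crux `CoreLinearInvertibility`, stmt-NavierStokesRegularity-17973): for `λ < 1` there is
`K > 0` such that for every measurable `a ∈ X_λ` the logarithmic potential `ψ_a = N ∗ a` converges
absolutely with `|ψ_a(x)| ≤ K(1+|x|)‖a‖_{X_λ}`, `∫ Φ⁻¹(Φψ_a)² ≤ K‖a‖²_{X_λ}`, and the first moments obey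
`|∫ x_i a| ≤ (∫|x|²G_λ)^{1/2} ‖a‖_{X_λ}`. [folklore] -/
theorem stub_oddArnoldToolsB :
    ∀ lam : ℝ, lam < 1 → ∃ K : ℝ, 0 < K ∧ ∀ a : EuclideanSpace ℝ (Fin 2) → ℝ,
      AEStronglyMeasurable a volume → Integrable (fun x => (gaussWeightLam lam x)⁻¹ * a x ^ 2) →
      (∀ x : EuclideanSpace ℝ (Fin 2),
        Integrable (fun y => (2 * Real.pi)⁻¹ * Real.log ‖x - y‖ * a y) ∧
        |∫ y, (2 * Real.pi)⁻¹ * Real.log ‖x - y‖ * a y| ≤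
          K * (1 + ‖x‖) * Real.sqrt (∫ y, (gaussWeightLam lam y)⁻¹ * a y ^ 2)) ∧
      (∀ ψ : EuclideanSpace ℝ (Fin 2) → ℝ, (∀ x, ψ x = ∫ y, (2 * Real.pi)⁻¹ * Real.log ‖x - y‖ * a y) →
        Integrable (fun x => (kerWeight ‖x‖)⁻¹ * (kerWeight ‖x‖ * ψ x) ^ 2) ∧
        ∫ x, (kerWeight ‖x‖)⁻¹ * (kerWeight ‖x‖ * ψ x) ^ 2 ≤
          K * ∫ x, (gaussWeightLam lam x)⁻¹ * a x ^ 2) ∧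
      ∀ i : Fin 2, |∫ x : EuclideanSpace ℝ (Fin 2), x i * a x| ≤
        Real.sqrt (∫ x : EuclideanSpace ℝ (Fin 2), ‖x‖ ^ 2 * gaussWeightLam lam x) *
          Real.sqrt (∫ x, (gaussWeightLam lam x)⁻¹ * a x ^ 2) := by
  intro lam hlam
  obtain ⟨K₁, hK₁, h₁⟩ := arnold_logPotential_bound hlam
  obtain ⟨K₂, hK₂, h₂⟩ := arnold_integral_kerWeight_mul_logPotential_sq_le hlam
  refine ⟨max K₁ K₂, lt_max_of_lt_left hK₁, fun a ham haX => ⟨fun x => ⟨(h₁ a ham haX x).1, ?_⟩,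
    fun ψ hψ => ⟨(h₂ a ψ ham haX hψ).1, ?_⟩, arnold_abs_moment_le hlam ham haX⟩⟩
  · refine (h₁ a ham haX x).2.trans ?_
    gcongr
    exact le_max_left _ _
  · refine (h₂ a ψ ham haX hψ).2.trans ?_
    have h0 : 0 ≤ ∫ x, (gaussWeightLam lam x)⁻¹ * a x ^ 2 :=
      integral_nonneg fun x => mul_nonneg (inv_nonneg.2 (gaussWeightLam_pos hlam x).le) (sq_nonneg _)
    exact mul_le_mul_of_nonneg_right (le_max_right _ _) h0

end Summit.NavierStokesRegularity.NavierStokesRegularity.Theorems
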